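import Mathlib
import Literature.NumberTheory.Automorphic.UnitaryGroupAutomorphicRep
import Literature.NumberTheory.Automorphic.UnitaryLimitsOfDiscreteSeries
import Literature.NumberTheory.Automorphic.UnitaryGroupLimitOfDiscreteSeriesAt
import Literature.NumberTheory.Automorphic.ReciprocityGLn
import Literature.NumberTheory.GaloisRepresentations.FramedRepTwist
import Literature.NumberTheory.GaloisRepresentations.IntegralGaloisActionProofs
import Literature.NumberTheory.GaloisRepresentations.TwistedSumAssembly
import Literature.NumberTheory.Automorphic.UnitaryCoherentGaloisRep
import Summits.Langlands.Langlands.Theorems.IrreducibilityBySelfDualityIrreducibleGL3CMContinuousSemisimplification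

/-!
# Goldring–Koskivirta for the quasi-split unitary group, rational-prime control, twisted
# (stub `stub_gkPlacewise` of line `grs-explicit-descent`, crux `HostInducedRep`, stmt-Langlands-10902)

The registered stub `stub_gkPlacewise` (S4 of the line) asks, for a cuspidal `σ` on Mok's
quasi-split `U_{K/F₀}(2n)` (`K/F₀` CM quadratic, `F₀` totally real) whose infinitesimal character at
every real place has half-integral doubly-regular shape and which is unramified above the prime
`ℓ ∤ disc F₀`, and for every `ℓ`-adic character `θ` of `Γ_K`, for a continuous semisimple
`r : Γ_K → GL_{2n}(ℚ̄_ℓ)` with `r ≃ ρ_σ ⊗ θ` read on Frobenius characteristic polynomials at EVERY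
finite place `u ∤ ℓ` of `K` with `e(u ∣ F₀) = 1` where `σ` is hyperspecial-unramified.

## Print audit (this file's raison d'être)

* **Goldring–Koskivirta**, Invent. Math. 217 (2019) = arXiv:1507.05032, **Thm. 3.5.5** (p. 19,
  "LDS, unitary case"), verbatim: "Suppose `π` is a cuspidal automorphic representation of `G` whose
  archimedean component `π_∞` is a `C`-algebraic, non-degenerate limit of discrete series. Assume
  `p ∉ Ram(G) ∪ Ram(π)`. Then there exists a unique semisimple Galois representation
  `R_{p,ι}(π) : Gal(F̄/F) → GL(m, ℚ̄_p)` such that, for all primes `w` of `F` which lie over some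
  prime `v ∉ Ram(G) ∪ Ram(π)`, the representation `R_{p,ι}(π)` is unramified at `w` and there is an
  isomorphism of Weil–Deligne representations
  `(R_{p,ι}(π)|_{W_{F_w}})^{ss} ≅ ι⁻¹ rec_{F_w}(BC(π_v)_w ⊗ |·|_w^{(1-m)/2})`" — here (p. 19, before
  the theorem) `(B, V, *, ⟨,⟩, h̃)` is a unitary Kottwitz datum, `G` its unitary SIMILITUDE group
  (a `ℚ`-group), `F` "the imaginary CM field given by the center of `B`", `m = (dim_F End_B V)^{1/2}`,
  `BC(π_v)_w` "as in [HLTT]"; p. 9: "`Ram(G)` denote[s] the set of primes where `G` is ramified"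
  (RATIONAL primes); p. 14: "`Ram(π)` … the set of places where `π` is ramified,
  `Ram(G, π) = Ram(G) ∪ Ram(π)`".  **The printed control set is indexed by rational primes**
  (`v` a prime of `ℚ`), exactly as recorded in `Cruxes/HostInducedRep/Disproof.lean` §6
  (`HostInducedRepRatControl`); it is NOT the placewise set of the registered stub.
  (p. 9 also carries the standing "Assume `p > 2`" for Kisin's Hodge-type integral models; Thm. 3.5.5
  does not restate it and the unitary case is PEL — not rendered below, flagged here.)
* **Fakhruddin–Pilloni**, J. Inst. Math. Jussieu (2023) = arXiv:1910.03790, **§9**: the only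
  Galois-representation theorems printed there are Thm. 9.8 (regular) and **Thm. 9.10** (weakly
  regular odd, for `GL_n` over a CM/totally real `L`, placewise: "unramified at all finite places
  `v ∤ p` for which `π_v` is unramified", proof = Mok descent Thm. 9.6 + Pilloni–Stroh / GK), already
  vendored as `Literature.NumberTheory.Automorphic.FakhruddinPilloni2021_galoisRep_of_weaklyRegular_odd`;
  there is NO printed statement in §9 for cuspidal representations of the unitary (similitude)
  group itself.  What §9 does print for the unitary group (p. 46, proof of Thm. 9.11) is the
  extension of a cuspidal `π̃` on `U(n)` to a cuspidal `π̃'` on `GU(n)` with prescribed algebraic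
  central character ([Chenevier], Hasse norm theorem), sphericity and Satake parameters being
  compatible under `ĜU → Û` "and similarly at archimedean places" — the `U → GU` passage used below.
* Boxer, arXiv:1507.05922 (cited by GK as an alternative engine): main theorem is the congruence
  Thm. 1.4; no unitary Galois-representation statement with a control set is printed there.

## What is here

* (now `Literature.NumberTheory.Automorphic.GoldringKoskivirta2019_galoisRep_unitary`, landed as
  p80140 from the inline statement of the first version of this file) the printed theorem as a named
  fact over the tree's `UnitaryGroup.*` vocabulary (Mok's quasi-split `U_{K/F₀}(N)` = the unitary
  group of the Kottwitz datum `B = K`, `V = K^N`; archimedean hypothesis = the tree's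
  `UnitaryGroup.IsNondegenerateLimitOfDiscreteSeriesAt`, whose `LDSDatum` has C-algebraicity
  `λ ∈ ρ + X*(T)` built in; control by RATIONAL primes `p ≠ ℓ` unramified in `K` above which `σ`
  is unramified; conclusion in the rendering of the accepted lang.S27
  `exists_galoisRep_of_regularAlgebraic`: arithmetic-Frobenius characteristic polynomial
  `arithFrobPolyOfSatake ι q_u N β`).
* `stub_gkPlacewise_ratControl` — the HONEST form of the stub, PROVED from that fact: hypotheses of
  the registered signature except that the archimedean clause is the non-degenerate-LDS clause of
  the fact, and in the conclusion the guard `e(u ∣ F₀) = 1` is replaced by the rational-prime guard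
  "every place `u'` of `K` over the rational prime below `u` is unramified over `ℚ` and `σ` is
  unramified at `u'`"; the twist by `θ` (`FramedRep.twist` by `det ∘ θ`,
  `charpoly (t • A) = (charpoly A).scaleRoots t`) and the semisimplification
  (`stub_continuousSemisimplification`) are carried out here.

## References

* W. Goldring, J.-S. Koskivirta, Invent. Math. 217 (2019), Thm. 3.5.5, §2.1.3, §2.4, §11.1. [GoldringKoskivirta2019]
* N. Fakhruddin, V. Pilloni, J. Inst. Math. Jussieu 22 (2023), §9.2 (proof of Thm. 9.11). [FakhruddinPilloni2021]
* M. Harris, K.-W. Lan, R. Taylor, J. Thorne, Res. Math. Sci. 3 (2016), §1 (`BC(π_v)_w`), Cor. 1.3. [HarrisLanTaylorThorneRMS2016]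
* C. P. Mok, Mem. AMS 1108 (2015), §2.1 (`ξ_1`), §4.3. [Mok2014]
-/

set_option linter.dupNamespace false -- project-wide option (lakefile weak.linter.dupNamespace); `Summit.Langlands.Langlands` is the mandated namespace

open scoped BigOperators Polynomial Classical MatrixGroups
open Polynomial IsDedekindDomain NumberField
open Literature.NumberTheory.Automorphic Literature.NumberTheory.GaloisRepresentations

noncomputable section

namespace Summit.Langlands.Langlands.Theorems.HostInducedRep.GrsExplicitDescent

/-! ## The named fact

The engine is the named fact `Literature.NumberTheory.Automorphic.GoldringKoskivirta2019_galoisRep_unitary`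
(Goldring–Koskivirta 2019, Thm. 3.5.5 for Mok's quasi-split `U_{K/F₀}(N)`, rational-prime control;
file `Literature/NumberTheory/Automorphic/UnitaryCoherentGaloisRep.lean`, written inline in the first
version of this file and relocated by the gate, p80140), taken as the hypothesis `hGK` below. -/

/-! ## Linear algebra of the twist: `charpoly (c • M) = (charpoly M).scaleRoots c` -/

/-- Over a field, scaling a matrix by `c ≠ 0` scales the roots of its characteristic polynomial:
`charpoly (c • M) = (charpoly M).scaleRoots c` (both sides composed with `X ↦ c X` equal
`cⁿ · charpoly M`, `TwistedSum.charpoly_smul_comp_C_mul_X` and `scaleRoots_eval₂_mul_of_commute`,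
and composition with `c X` is injective). [folklore] -/
theorem charpoly_smul_eq_scaleRoots {m : Type*} [Fintype m] [DecidableEq m] {k : Type*} [Field k]
    (M : Matrix m m k) {c : k} (hc : c ≠ 0) :
    (c • M).charpoly = M.charpoly.scaleRoots c := by
  have h1 := TwistedSum.charpoly_smul_comp_C_mul_X M c
  have h2 : (M.charpoly.scaleRoots c).comp (C c * X) = C (c ^ Fintype.card m) * M.charpoly := by
    have h := scaleRoots_eval₂_mul_of_commute (p := M.charpoly) (C : k →+* k[X]) X c
      (Commute.all _ _) (fun _ _ ↦ Commute.all _ _)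
    rw [eval₂_C_X, Matrix.charpoly_natDegree_eq_dim, ← C_pow] at h
    exact h
  have h3 : ∀ p : k[X], (p.comp (C c * X)).comp (C c⁻¹ * X) = p := fun p ↦ by
    rw [comp_assoc, mul_comp, C_comp, X_comp, ← mul_assoc, ← C_mul, mul_inv_cancel₀ hc, C_1,
      one_mul, comp_X]
  rw [← h3 (c • M).charpoly, ← h3 (M.charpoly.scaleRoots c), h1, h2]

/-! ## Rank-one Frobenius bookkeeping for the twisting character `θ` -/

section RankOne

variable {K : Type} [Field K] [NumberField K] {A : Type*} [CommRing A] [TopologicalSpace A]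

omit [NumberField K] in
/-- In rank one the Frobenius clause `θ.HasFrobCharpolyAt u (X - C t)` says that every arithmetic
Frobenius at every `𝔓 ∣ u` has the single matrix entry `t`, i.e. `det θ(Frob) = t`. [folklore] -/
theorem det_eq_of_hasFrobCharpolyAt_X_sub_C [IsTopologicalRing A] {u : HeightOneSpectrum (𝓞 K)}
    (θ : FramedGaloisRep K A 1) {t : A} (h : θ.HasFrobCharpolyAt u (X - C t))
    {𝔓 : Ideal (absIntegers (𝓞 K) K)} (h𝔓 : 𝔓 ∈ u.primesAbove)
    {φ : Field.absoluteGaloisGroup K} (hφ : IsArithFrobAt (𝓞 K) φ 𝔓) :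
    ((FramedRep.det θ φ : Aˣ) : A) = t := by
  have hc := h 𝔓 h𝔓 φ hφ
  rw [FramedRep.charpoly, Matrix.charpoly, Matrix.det_fin_one, Matrix.charmatrix_apply_eq,
    sub_right_inj, C_inj] at hc
  rw [FramedRep.det_apply, Matrix.GeneralLinearGroup.val_det_apply, Matrix.det_fin_one]
  exact hc

omit [NumberField K] in
/-- A rank-one framed representation is determined at `φ` by its characteristic polynomial
`X - C (the entry)`. [folklore] -/
theorem eq_of_charpoly_eq_rankOne (θ : FramedGaloisRep K A 1) {φ φ' : Field.absoluteGaloisGroup K}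
    (h : FramedRep.charpoly θ φ = FramedRep.charpoly θ φ') : θ φ = θ φ' := by
  simp only [FramedRep.charpoly, Matrix.charpoly, Matrix.det_fin_one, Matrix.charmatrix_apply_eq,
    sub_right_inj, C_inj] at h
  refine Units.ext (Matrix.ext fun i j ↦ ?_)
  rw [Subsingleton.elim i 0, Subsingleton.elim j 0]
  exact h

/-- **In rank one the Frobenius clause forces unramifiedness**: if every arithmetic Frobenius at
every `𝔓 ∣ u` has the same characteristic polynomial `P`, then `θ` kills the inertia groups above
`u` (for `τ ∈ I_𝔓` and a Frobenius `φ` at `𝔓`, `τφ` is again a Frobenius,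
`isArithFrobAt_mul_iff_of_mem_inertia`; Frobenii exist, `exists_isArithFrobAt_of_mem_primesAbove_holds`).
(Same argument as `Cruxes/HostInducedRep/Disproof.lean` §2.) [folklore] -/
theorem isUnramifiedAt_of_hasFrobCharpolyAt_rankOne {u : HeightOneSpectrum (𝓞 K)}
    (θ : FramedGaloisRep K A 1) {P : A[X]} (hP : θ.HasFrobCharpolyAt u P) : θ.IsUnramifiedAt u := by
  intro 𝔓 h𝔓 τ hτ
  obtain ⟨φ, hφ⟩ := HeightOneSpectrum.exists_isArithFrobAt_of_mem_primesAbove_holds h𝔓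
  have hτφ : IsArithFrobAt (𝓞 K) (τ * φ) 𝔓 := (isArithFrobAt_mul_iff_of_mem_inertia hτ).mpr hφ
  have h1 : θ (τ * φ) = θ φ :=
    eq_of_charpoly_eq_rankOne θ ((hP 𝔓 h𝔓 _ hτφ).trans (hP 𝔓 h𝔓 φ hφ).symm)
  rwa [map_mul, mul_eq_right] at h1

end RankOne

/-! ## Ramification bookkeeping: `ℓ ∤ disc F₀` and `e(u ∣ F₀) = 1` give `e(u ∣ ℚ) = 1` -/

section Ramification

variable {F₀ K : Type} [Field F₀] [NumberField F₀] [Field K] [NumberField K] [Algebra F₀ K]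

/-- If the rational prime `ℓ` does not divide `disc F₀` then every prime of `𝓞 F₀` above `ℓ` has
ramification index `1` over `ℤ` (Mathlib `NumberField.not_dvd_discr_iff_forall_mem` and
`Ideal.ramificationIdx_eq_one`). [folklore] -/
theorem ramificationIdx_int_eq_one_of_not_dvd_discr {ℓ : ℕ} [Fact ℓ.Prime]
    (h : ¬ ((ℓ : ℤ) ∣ NumberField.discr F₀)) (v : HeightOneSpectrum (𝓞 F₀))
    (hv : ((ℓ : ℕ) : 𝓞 F₀) ∈ v.asIdeal) : v.asIdeal.ramificationIdx ℤ = 1 := by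
  have hp : Prime (ℓ : ℤ) := Nat.prime_iff_prime_int.mp Fact.out
  haveI := (NumberField.not_dvd_discr_iff_forall_mem F₀ (𝓞 F₀) hp).mp h v.asIdeal v.isPrime
    (by exact_mod_cast hv)
  exact Ideal.ramificationIdx_eq_one _ _

omit [NumberField F₀] [NumberField K] in
/-- Membership of `ℓ` in a place `u` of `K` read on `F₀`: `ℓ ∈ u ∩ 𝓞 F₀ ↔ ℓ ∈ u` (local copy of
`natCast_mem_under_iff` of `QuadraticWindowHostInducedRepPatchDescend`, not imported to keep this
file independent of the neighbouring stub). [folklore] -/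
private theorem natCast_mem_asIdeal_under_iff (ℓ : ℕ) (u : HeightOneSpectrum (𝓞 K)) :
    ((ℓ : ℕ) : 𝓞 F₀) ∈ (u.under (𝓞 F₀)).asIdeal ↔ ((ℓ : ℕ) : 𝓞 K) ∈ u.asIdeal := by
  rw [HeightOneSpectrum.under_asIdeal, Ideal.under_def, Ideal.mem_comap, map_natCast]

omit [NumberField K] in
/-- **`ℓ ∉ Ram(G)` from the stub's hypotheses**: if `ℓ ∤ disc F₀` and every place of `K` above `ℓ`
is unramified over `F₀`, then every place of `K` above `ℓ` is unramified over `ℚ`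
(`e(u ∣ ℚ) = e(u ∩ 𝓞 F₀ ∣ ℚ) · e(u ∣ F₀)`, Mathlib `Ideal.ramificationIdx_tower`). [folklore] -/
theorem ramificationIdx_int_eq_one_of_tower {ℓ : ℕ} [Fact ℓ.Prime]
    (hdisc : ¬ ((ℓ : ℤ) ∣ NumberField.discr F₀))
    (hK : ∀ u : HeightOneSpectrum (𝓞 K), ((ℓ : ℕ) : 𝓞 K) ∈ u.asIdeal →
      u.asIdeal.ramificationIdx (𝓞 F₀) = 1)
    (u : HeightOneSpectrum (𝓞 K)) (hu : ((ℓ : ℕ) : 𝓞 K) ∈ u.asIdeal) :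
    u.asIdeal.ramificationIdx ℤ = 1 := by
  have hv : ((ℓ : ℕ) : 𝓞 F₀) ∈ (u.under (𝓞 F₀)).asIdeal := (natCast_mem_asIdeal_under_iff ℓ u).mpr hu
  rw [Ideal.ramificationIdx_tower (R := ℤ) (u.asIdeal.under (𝓞 F₀)) u.asIdeal, hK u hu, mul_one]
  exact ramificationIdx_int_eq_one_of_not_dvd_discr hdisc (u.under (𝓞 F₀)) hv

end Ramification

/-! ## The honest stub: Goldring–Koskivirta with rational-prime control, twisted by `θ` -/

/-- **Stub S4 in its honest form** (`stub_gkPlacewise` of line `grs-explicit-descent`, crux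
`HostInducedRep`, from the vendored `GoldringKoskivirta2019_galoisRep_unitary`).  Let `F₀` be
totally real, `K/F₀` a totally complex quadratic extension with involution `cK ≠ 1`, `ℓ ∤ disc F₀`
a prime with every place of `K` above `ℓ` unramified over `F₀`, and `σ` a cuspidal automorphic
representation of Mok's `U_{K/F₀}(2n)` unramified above `ℓ` whose component at every real place is
a non-degenerate limit of discrete series (`UnitaryGroup.IsNondegenerateLimitOfDiscreteSeriesAt`).
Then for every `ℓ`-adic character `θ : Γ_K → GL₁(ℚ̄_ℓ)` there is a continuous semisimple
`r : Γ_K → GL_{2n}(ℚ̄_ℓ)` — the semisimplification of `ρ_σ ⊗ (det ∘ θ)` — such that at every finite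
place `u` of `K` not above `ℓ`, over a rational prime above which `K/ℚ` is unramified and `σ` is
unramified at every place (the PRINTED control set of GK Thm. 3.5.5), for every base-change Satake
parameter `β` of `σ` at `u` and arithmetic-Frobenius value `t` of `θ` at `u`, `r` is unramified at
`u` with characteristic polynomial `(arithFrobPolyOfSatake ι q_u (2n) β).scaleRoots t`.
Differences from the registered signature: the named-fact hypothesis; the archimedean clause (LDS,
as printed, instead of the infinitesimal-character shape); the guard `e(u ∣ F₀) = 1` replaced by the
rational-prime guard (which implies it). -/
theorem stub_gkPlacewise_ratControl : Literature.NumberTheory.Automorphic.GoldringKoskivirta2019_galoisRep_unitary → ∀ (F₀ K : Type) [Field F₀] [NumberField F₀] [Field K] [NumberField K] [Algebra F₀ K] (cK : K ≃ₐ[F₀] K), IsTotallyReal F₀ → Module.finrank F₀ K = 2 → ∀ (hc : cK ≠ 1), IsTotallyComplex K → ∀ (n : ℕ) (ℓ : ℕ) [Fact ℓ.Prime] (ι : PadicAlgCl ℓ ≃+* ℂ), ¬ ((ℓ : ℤ) ∣ NumberField.discr F₀) → (∀ u : HeightOneSpectrum (𝓞 K), ((ℓ : ℕ) : 𝓞 K)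 ∈ u.asIdeal → u.asIdeal.ramificationIdx (𝓞 F₀) = 1) → ∀ (hcptK : isCompact_glFiniteIntegralLevel (2 * n) K) (σ : UnitaryGroup.CuspidalAutomorphicRepData F₀ K cK (2 * n) hcptK), (∀ (w : {w : InfinitePlace K // w.IsComplex}) (hw : cK • w.1 = w.1), ∃ (p q : ℕ) (d : LDSDatum p q), UnitaryGroup.IsNondegenerateLimitOfDiscreteSeriesAt F₀ K cK (2 * n) (StdForm.antidiagonal (2 * n)) hcptK σ.1 hw hc d) → (∀ u : HeightOneSpectrum (𝓞 K), ((ℓ : ℕ) : 𝓞 K) ∈ u.asIdeal → UnitaryGroup.IsUnramifiedAt F₀ K cK (2 * n) hcptK σ.1 u) → ∀ θ : FramedGaloisRep K (PadicAlgCl ℓ) 1, ∃ r : FramedGaloisRep K (PadicAlgCl ℓ) (2 * n), r.toGaloisRep.IsSemisimple ∧ ∀ (u : HeightOneSpectrum (𝓞 K)) (β : Multiset ℂ) (t : PadicAlgCl ℓ), ((ℓ : ℕ) : 𝓞 F₀) ∉ (u.under (𝓞 F₀)).asIdeal → (∀ u' : HeightOneSpectrum (𝓞 K), u'.asIdeal.under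 ℤ = u.asIdeal.under ℤ → u'.asIdeal.ramificationIdx ℤ = 1 ∧ UnitaryGroup.IsUnramifiedAt F₀ K cK (2 * n) hcptK σ.1 u') → UnitaryGroup.HasBaseChangeSatakeAt F₀ K cK (2 * n) hcptK σ.1 u β → θ.HasFrobCharpolyAt u (X - C t) → r.IsUnramifiedAt u ∧ r.HasFrobCharpolyAt u ((arithFrobPolyOfSatake ι u.residueCard (2 * n) β).scaleRoots t) := by
  intro hGK F₀ K _ _ _ _ _ cK hTR h2 hc htc n ℓ _ ι hdisc hKℓ hcptK σ harch hunrσ θ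
  -- `ℓ ∉ Ram(G) ∪ Ram(σ)` in the form of the fact
  have hℓ : ∀ u : HeightOneSpectrum (𝓞 K), ((ℓ : ℕ) : 𝓞 K) ∈ u.asIdeal →
      u.asIdeal.ramificationIdx ℤ = 1 ∧ UnitaryGroup.IsUnramifiedAt F₀ K cK (2 * n) hcptK σ.1 u :=
    fun u hu ↦ ⟨ramificationIdx_int_eq_one_of_tower hdisc hKℓ u hu, hunrσ u hu⟩
  -- Goldring–Koskivirta: `r₀ = ρ_{σ,ι}`
  obtain ⟨r₀, -, hr₀⟩ := hGK F₀ K cK hTR h2 hc htc (2 * n) ℓ ι hcptK σ harch hℓ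
  -- twist by the character `χ = det ∘ θ` and semisimplify
  set χ : Field.absoluteGaloisGroup K →ₜ* (PadicAlgCl ℓ)ˣ := FramedRep.det θ with hχ
  obtain ⟨r, hrss, hcp, hker⟩ :=
    IrreducibleGL3CM.stub_continuousSemisimplification K ℓ (2 * n) (FramedRep.twist r₀ χ)
  refine ⟨r, hrss, fun u β t hv hrat hbc hθ ↦ ?_⟩
  have hvK : ((ℓ : ℕ) : 𝓞 K) ∉ u.asIdeal := fun h ↦ hv ((natCast_mem_asIdeal_under_iff ℓ u).mpr h)
  obtain ⟨hunr₀, hchar₀⟩ := hr₀ u β hvK hrat hbc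
  have hθunr : θ.IsUnramifiedAt u := isUnramifiedAt_of_hasFrobCharpolyAt_rankOne θ hθ
  refine ⟨fun 𝔓 h𝔓 τ hτ ↦ hker τ ?_, fun 𝔓 h𝔓 φ hφ ↦ ?_⟩
  · -- inertia: `r₀ τ = 1`, `θ τ = 1`, hence `(r₀ ⊗ χ) τ = 1`
    rw [FramedRep.twist_apply, hunr₀ 𝔓 h𝔓 τ hτ, mul_one, hχ, FramedRep.det_apply, hθunr 𝔓 h𝔓 τ hτ,
      map_one, map_one]
  · -- Frobenius: `charpoly (t • A) = (charpoly A).scaleRoots t`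
    have ht : ((χ φ : (PadicAlgCl ℓ)ˣ) : PadicAlgCl ℓ) = t := by
      rw [hχ]; exact det_eq_of_hasFrobCharpolyAt_X_sub_C θ hθ h𝔓 hφ
    rw [hcp φ, FramedRep.charpoly, FramedRep.coe_twist_apply,
      charpoly_smul_eq_scaleRoots _ (Units.ne_zero _), ← FramedRep.charpoly, hchar₀ 𝔓 h𝔓 φ hφ, ht]

end Summit.Langlands.Langlands.Theorems.HostInducedRep.GrsExplicitDescent

end
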